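import Summits.CriticalPhenomena.PercolationContinuityZ3.Theorems.PercNearOneGluingNoHeavyLowerTailFibreSwitchingSHK3Cert
import Mathlib.Tactic.FinCases
import Mathlib.Tactic.Ring
import Mathlib.Tactic.Linarith
import Mathlib.Tactic.NormNum
import HarnessLib

/-!
# `NoHeavyLowerTail` (stmt-CriticalPhenomena-4575) — THEOREM `M(SHK3⁺)`: the three-copy FIBRE (coefficientwise,
# "comb") positivity of `3PT-LB = SHK3⁺ = Sahi's E₃ of the three pairwise separations` on EVERY finite graph

Support file (new-inequality factory seat `prim-ineq-gen-1`, gen 6; `--supports stmt-CriticalPhenomena-4575`).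
No named facts, no sorries.  Part I is `…FibreSwitchingSHK3Cert` (fibre bijections, the unswitched potential
`certU` and its type table `lamZ`); this is Part II (kernel, symmetrisation identity, theorem).

**Setting.**  `V` a finite vertex type, `D : Finset (Sym2 V)` a set of pairs, `a b c : V`.  A triple
`x = (x 0, x 1, x 2)` of configurations `x i ⊆ D` has the PROFILE `e ↦ #{i : e ∈ x i}`
(`FibreSwitching.profile`); the FIBRE of a profile `k` is the set of triples inside `D` with that profile
(`FibreSwitching.fibre D k`).  Each configuration has one of five three-point TYPES
(`code`: `0 = Q = a|b|c`, `1 = Pa = bc|a`, `2 = Pb = ac|b`, `3 = Pc = ab|c`, `4 = T = abc`), and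
`shk3Kernel` is the integer kernel (six times the symmetric trilinear form) of the cubic
`F = (q + u_a + u_b + u_c + 2t)(qt − u_au_b − u_au_c − u_bu_c) − u_au_bu_c` (`sum_shk3Kernel_mul`):
`{T,T,Q} ↦ 4`, `{T,Q,Q} ↦ 2`, `{T,Q,P} ↦ 1`, `{T,P,P'} ↦ −2`, `{Q,P,P'} ↦ −1`, `{P,P,P'} ↦ −2`,
`{Pa,Pb,Pc} ↦ −4` (`P ≠ P'` petal types), all other patterns `0`.

**Theorem** (`fibre_shk3Kernel_nonneg`).  For every `D, a, b, c` and EVERY profile `k`,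
`0 ≤ Σ_{x ∈ fibre D k} shk3Kernel (code x₀) (code x₁) (code x₂)`;
in the factory's counts of ordered fibre elements by type pattern this is
`4N_{TTQ} + 2N_{TQQ} + N_{TQP} ≥ 2N_{TPP'} + N_{QPP'} + 2N_{PPP'} + 4N_{PaPbPc}`.
Since the product weight of a triple is a nonnegative function of its profile, this is strictly finer than the
law-level theorem `F ≥ 0` (`ThreePointLB.threePointLB_PrW`, prim-lit-2 / prim-cert-2), which is recovered for
every weight vector at once (`sum_wt3W_shk3Kernel_nonneg`); in generating-function language it says that
`(Z + F_T)·(F_T F_Q − F_aF_b − F_aF_c − F_bF_c) − F_aF_bF_c` has nonnegative coefficients, where `F_τ(z)` is the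
generating polynomial of the configurations of type `τ` and `Z = Π_e (1 + z_e)`.  This was conjectured from
an exhaustive census (all 3-terminal multigraphs with ≤ 7 vertices and ≤ 10 edges, all profiles; factory
notes FINDING-7/8) and is, to our knowledge, the first fibre-positivity theorem for a cubic three-point
functional (the quadratic one, fibre positivity of the Aas–Gladkov form, is `AntipodalStrongHarris`).

**Proof** (factory FINDING-11: "switching certificates are fibre certificates").  The four switchings
`Φ₁…Φ₄` of the proof of `3PT-LB` (`ThreePointLB.phi1 … phi4`) are two-region splicings
`DecisionTree.splice3`, hence edgewise copy-permuting injections of the triples inside `D`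
(`DecisionTree.permutesCopies_splice3`, `splice3_injective`), hence bijections of every fibre
(`FibreSwitching.sum_fibre_comp_eq_of_injOn`; `sum_fibre_phi1 … sum_fibre_phi4`); so the fibre sum of the
pointwise certificate `S = λ₀ + Σᵢ λᵢ ∘ Φᵢ ≤ 0` (`ThreePointLB.cert_nonpos`) equals the fibre sum of the
UNswitched potential `Λ = λ₀ + Σᵢ λᵢ` (`sum_fibre_cert`), a function of the three types (`certU_eq`).  Fibres
are invariant under permuting the copies (`sum_fibre_comp_perm`), so that fibre sum is the fibre sum of the
copy-symmetrisation of `Λ`, which is `−shk3Kernel` identically on type triples (`lamZ_symm`, a finite check —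
the cubic identity `E[S] = −F` of the switching proof read coefficientwise).  Hence
`Σ_fibre shk3Kernel = −6 Σ_fibre S ≥ 0`.
-/

noncomputable section

namespace Summit.CriticalPhenomena.PercolationContinuityZ3.Theorems

namespace FibreSHK3

open Finset Literature.Probability.Percolation Literature.Probability.Percolation.DecisionTree
open Literature.Probability.Percolation.Gladkov
open FibreSwitching ThreePointLB
open scoped Classical

variable {V : Type*}

/-! ### The kernel of `F = SHK3⁺` and the coefficientwise cubic identity -/

/-- Petal types `Pa, Pb, Pc` (`1, 2, 3`). [this work] -/
def isPetal (l : Fin 5) : Bool := decide (l = 1 ∨ l = 2 ∨ l = 3)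

/-- The integer kernel (six times the symmetric trilinear form; labels `0 = Q`, `1,2,3 =` petals, `4 = T`) of
`F = SHK3⁺ = (q + Σu + 2t)(qt − e₂(u)) − e₃(u)`: `{T,T,Q} ↦ 4`, `{T,Q,Q} ↦ 2`, `{T,Q,P} ↦ 1`,
`{T,P,P'} ↦ −2`, `{Q,P,P'} ↦ −1`, `{Pa,Pb,Pc} ↦ −4`, `{P,P,P'} ↦ −2` (`P ≠ P'`), else `0`. [this work] -/
def shk3Kernel (l1 l2 l3 : Fin 5) : ℤ :=
  let nT := (if l1 = 4 then 1 else 0) + (if l2 = 4 then 1 else 0) + (if l3 = 4 then 1 else 0)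
  let nQ := (if l1 = 0 then 1 else 0) + (if l2 = 0 then 1 else 0) + (if l3 = 0 then 1 else 0)
  let nP := (if isPetal l1 then 1 else 0) + (if isPetal l2 then 1 else 0) + (if isPetal l3 then 1 else 0)
  let distinctPetals : Bool :=
    (!(isPetal l1 && isPetal l2 && decide (l1 = l2))) && (!(isPetal l1 && isPetal l3 && decide (l1 = l3))) &&
      (!(isPetal l2 && isPetal l3 && decide (l2 = l3)))
  let allEq : Bool := decide (l1 = l2) && decide (l2 = l3)
  if nT = 2 ∧ nQ = 1 then 4
  else if nT = 1 ∧ nQ = 2 then 2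
  else if nT = 1 ∧ nQ = 1 then 1
  else if nT = 1 ∧ nP = 2 ∧ distinctPetals then -2
  else if nQ = 1 ∧ nP = 2 ∧ distinctPetals then -1
  else if nP = 3 ∧ distinctPetals then -4
  else if nP = 3 ∧ ¬ (allEq = true) then -2
  else 0

/-- `F = 3PT-LB = SHK3⁺` as a cubic in the five type masses `(q, u_a, u_b, u_c, t)`. [this work] -/
def shk3F (q ua ub uc t : ℝ) : ℝ :=
  (q + ua + ub + uc + 2 * t) * (q * t - (ua * ub + ua * uc + ub * uc)) - ua * ub * uc

/-- The value table of `shk3Kernel` (first index = outer). [this work] -/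
theorem shk3Kernel_table : ∀ l1 l2 l3 : Fin 5, shk3Kernel l1 l2 l3 =
    (![![![0, 0, 0, 0, 2], ![0, 0, -1, -1, 1], ![0, -1, 0, -1, 1], ![0, -1, -1, 0, 1], ![2, 1, 1, 1, 4]],
      ![![0, 0, -1, -1, 1], ![0, 0, -2, -2, 0], ![-1, -2, -2, -4, -2], ![-1, -2, -4, -2, -2], ![1, 0, -2, -2, 0]],
      ![![0, -1, 0, -1, 1], ![-1, -2, -2, -4, -2], ![0, -2, 0, -2, 0], ![-1, -4, -2, -2, -2], ![1, -2, 0, -2, 0]],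
      ![![0, -1, -1, 0, 1], ![-1, -2, -4, -2, -2], ![-1, -4, -2, -2, -2], ![0, -2, -2, 0, 0], ![1, -2, -2, 0, 0]],
      ![![2, 1, 1, 1, 4], ![1, 0, -2, -2, 0], ![1, -2, 0, -2, 0], ![1, -2, -2, 0, 0], ![4, 0, 0, 0, 0]]] :
      Fin 5 → Fin 5 → Fin 5 → ℤ) l1 l2 l3 := by
  decide

/-- **The kernel is that of `F`**: `Σ_{l₁,l₂,l₃} shk3Kernel(l⃗) m_{l₁} m_{l₂} m_{l₃} = 6·F(m)`. [this work] -/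
theorem sum_shk3Kernel_mul (m : Fin 5 → ℝ) :
    ∑ l1 : Fin 5, ∑ l2 : Fin 5, ∑ l3 : Fin 5, (shk3Kernel l1 l2 l3 : ℝ) * (m l1 * m l2 * m l3) =
      6 * shk3F (m 0) (m 1) (m 2) (m 3) (m 4) := by
  simp only [shk3Kernel_table, Fin.sum_univ_five]
  simp only [Matrix.cons_val_zero, Matrix.cons_val_one, Matrix.cons_val]
  norm_num [shk3F]
  ring

/-- **The copy-symmetrisation of the unswitched potential is `−shk3Kernel`** on every type triple (the cubic
identity `E[λ₀ + Σλᵢ] = −F` of the switching proof, read coefficient by coefficient; finite check). [this work] -/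
theorem lamZ_symm : ∀ l0 l1 l2 : Fin 5,
    lamZ l0 l1 l2 + lamZ l1 l0 l2 + lamZ l2 l1 l0 + lamZ l0 l2 l1 + lamZ l2 l0 l1 + lamZ l1 l2 l0 =
      - shk3Kernel l0 l1 l2 := by
  decide

/-! ### The theorem -/

section Main

variable [Fintype V] [DecidableEq V] (D : Finset (Sym2 V)) (a b c : V)

/-- `(0 1)` on `Fin 3`. [folklore] -/
private theorem s01_0 : (Equiv.swap (0 : Fin 3) 1) 0 = 1 := by decide
/-- `(0 1)` on `Fin 3`. [folklore] -/
private theorem s01_1 : (Equiv.swap (0 : Fin 3) 1) 1 = 0 := by decide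
/-- `(0 1)` on `Fin 3`. [folklore] -/
private theorem s01_2 : (Equiv.swap (0 : Fin 3) 1) 2 = 2 := by decide
/-- `(0 2)` on `Fin 3`. [folklore] -/
private theorem s02_0 : (Equiv.swap (0 : Fin 3) 2) 0 = 2 := by decide
/-- `(0 2)` on `Fin 3`. [folklore] -/
private theorem s02_1 : (Equiv.swap (0 : Fin 3) 2) 1 = 1 := by decide
/-- `(0 2)` on `Fin 3`. [folklore] -/
private theorem s02_2 : (Equiv.swap (0 : Fin 3) 2) 2 = 0 := by decide
/-- `(1 2)` on `Fin 3`. [folklore] -/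
private theorem s12_0 : (Equiv.swap (1 : Fin 3) 2) 0 = 0 := by decide
/-- `(1 2)` on `Fin 3`. [folklore] -/
private theorem s12_1 : (Equiv.swap (1 : Fin 3) 2) 1 = 2 := by decide
/-- `(1 2)` on `Fin 3`. [folklore] -/
private theorem s12_2 : (Equiv.swap (1 : Fin 3) 2) 2 = 1 := by decide
/-- The 3-cycle `(0 1)(1 2)`. [folklore] -/
private theorem r_0 : ((Equiv.swap (0 : Fin 3) 1).trans (Equiv.swap 1 2)) 0 = 2 := by decide
/-- The 3-cycle `(0 1)(1 2)`. [folklore] -/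
private theorem r_1 : ((Equiv.swap (0 : Fin 3) 1).trans (Equiv.swap 1 2)) 1 = 0 := by decide
/-- The 3-cycle `(0 1)(1 2)`. [folklore] -/
private theorem r_2 : ((Equiv.swap (0 : Fin 3) 1).trans (Equiv.swap 1 2)) 2 = 1 := by decide
/-- The 3-cycle `(1 2)(0 1)`. [folklore] -/
private theorem r'_0 : ((Equiv.swap (1 : Fin 3) 2).trans (Equiv.swap 0 1)) 0 = 1 := by decide
/-- The 3-cycle `(1 2)(0 1)`. [folklore] -/
private theorem r'_1 : ((Equiv.swap (1 : Fin 3) 2).trans (Equiv.swap 0 1)) 1 = 2 := by decide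
/-- The 3-cycle `(1 2)(0 1)`. [folklore] -/
private theorem r'_2 : ((Equiv.swap (1 : Fin 3) 2).trans (Equiv.swap 0 1)) 2 = 0 := by decide

/-- **THEOREM `M(SHK3⁺)` — fibre positivity of `3PT-LB = SHK3⁺ = E₃(pairwise separations)` on every finite
graph.**  For every finite vertex type `V`, every `D : Finset (Sym2 V)`, all `a b c : V` and EVERY profile
`k : Sym2 V → ℕ`, the fibre sum of the `SHK3⁺` kernel over the triples of configurations inside `D` with
profile `k` is nonnegative:  `0 ≤ Σ_{x ∈ fibre D k} shk3Kernel (code x₀) (code x₁) (code x₂)`, i.e.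
`4N_{TTQ} + 2N_{TQQ} + N_{TQP} − 2N_{TPP'} − N_{QPP'} − 2N_{PPP'} − 4N_{PaPbPc} ≥ 0` in every fibre.
Proof: `= −6 · Σ_{fibre} S ≥ 0` by `sum_fibre_certU_nonpos`, `certU_eq`, copy-symmetry of fibres and
`lamZ_symm`. [this work] -/
theorem fibre_shk3Kernel_nonneg (k : Sym2 V → ℕ) :
    0 ≤ ∑ x ∈ fibre D k,
      (shk3Kernel (code a b c (x 0)) (code a b c (x 1)) (code a b c (x 2)) : ℝ) := by
  set g : (Fin 3 → Finset (Sym2 V)) → ℝ :=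
    fun x => (lamZ (code a b c (x 0)) (code a b c (x 1)) (code a b c (x 2)) : ℝ) with hg
  have hU : ∑ x ∈ fibre D k, g x ≤ 0 := by
    have h := sum_fibre_certU_nonpos a b c D k
    rw [sum_congr rfl fun x _ => certU_eq a b c x] at h
    exact h
  -- the six relabellings of the copies
  have e01 := sum_fibre_comp_perm D (Equiv.swap 0 1) k g
  have e02 := sum_fibre_comp_perm D (Equiv.swap 0 2) k g
  have e12 := sum_fibre_comp_perm D (Equiv.swap 1 2) k g
  have er := sum_fibre_comp_perm D ((Equiv.swap 0 1).trans (Equiv.swap 1 2)) k g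
  have er' := sum_fibre_comp_perm D ((Equiv.swap 1 2).trans (Equiv.swap 0 1)) k g
  simp only [hg, s01_0, s01_1, s01_2, s02_0, s02_1, s02_2, s12_0, s12_1, s12_2, r_0, r_1, r_2,
    r'_0, r'_1, r'_2] at e01 e02 e12 er er'
  have hsym : ∑ x ∈ fibre D k,
      (shk3Kernel (code a b c (x 0)) (code a b c (x 1)) (code a b c (x 2)) : ℝ) =
      - 6 * ∑ x ∈ fibre D k, g x := by
    have h6 : 6 * ∑ x ∈ fibre D k, g x =
        ∑ x ∈ fibre D k, ((lamZ (code a b c (x 0)) (code a b c (x 1)) (code a b c (x 2)) : ℝ)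
          + (lamZ (code a b c (x 1)) (code a b c (x 0)) (code a b c (x 2)) : ℝ)
          + (lamZ (code a b c (x 2)) (code a b c (x 1)) (code a b c (x 0)) : ℝ)
          + (lamZ (code a b c (x 0)) (code a b c (x 2)) (code a b c (x 1)) : ℝ)
          + (lamZ (code a b c (x 2)) (code a b c (x 0)) (code a b c (x 1)) : ℝ)
          + (lamZ (code a b c (x 1)) (code a b c (x 2)) (code a b c (x 0)) : ℝ)) := by
      simp only [sum_add_distrib, hg]
      rw [e01, e02, e12, er, er']
      ring
    have hpt : ∀ x : Fin 3 → Finset (Sym2 V),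
        ((lamZ (code a b c (x 0)) (code a b c (x 1)) (code a b c (x 2)) : ℝ)
          + (lamZ (code a b c (x 1)) (code a b c (x 0)) (code a b c (x 2)) : ℝ)
          + (lamZ (code a b c (x 2)) (code a b c (x 1)) (code a b c (x 0)) : ℝ)
          + (lamZ (code a b c (x 0)) (code a b c (x 2)) (code a b c (x 1)) : ℝ)
          + (lamZ (code a b c (x 2)) (code a b c (x 0)) (code a b c (x 1)) : ℝ)
          + (lamZ (code a b c (x 1)) (code a b c (x 2)) (code a b c (x 0)) : ℝ)) =
        - (shk3Kernel (code a b c (x 0)) (code a b c (x 1)) (code a b c (x 2)) : ℝ) := by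
      intro x
      have h := lamZ_symm (code a b c (x 0)) (code a b c (x 1)) (code a b c (x 2))
      exact_mod_cast h
    rw [sum_congr rfl fun x _ => hpt x, sum_neg_distrib] at h6
    linarith
  rw [hsym]
  linarith

/-- **Corollary: `F ≥ 0` for every weight vector at once** (recovers `ThreePointLB.threePointLB_PrW` from the
fibres: the product weight of a triple is a nonnegative function of its profile,
`FibreSwitching.sum_wt3W_mul_nonneg_of_fibres`). [this work] -/
theorem sum_wt3W_shk3Kernel_nonneg {p : Sym2 V → ℝ} (hp0 : ∀ i, 0 ≤ p i) (hp1 : ∀ i, p i ≤ 1) :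
    0 ≤ ∑ x ∈ triples D, wt3W D p x *
      (shk3Kernel (code a b c (x 0)) (code a b c (x 1)) (code a b c (x 2)) : ℝ) :=
  sum_wt3W_mul_nonneg_of_fibres D hp0 hp1 _ fun k => fibre_shk3Kernel_nonneg D a b c k

end Main

end FibreSHK3

end Summit.CriticalPhenomena.PercolationContinuityZ3.Theorems

end
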